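import Summits.BirchSwinnertonDyer.BirchSwinnertonDyer.Theorems.KatoDescentPotSupersingularWildUpperUnitTwistRecordsClassO609
import Summits.BirchSwinnertonDyer.BirchSwinnertonDyer.Theorems.KatoDescentPotSupersingularWildUpperUnitTwistRecordsClassO610
import Summits.BirchSwinnertonDyer.BirchSwinnertonDyer.Theorems.KatoDescentPotSupersingularWildUpperUnitTwistRecordsClassO612
import Summits.BirchSwinnertonDyer.BirchSwinnertonDyer.Theorems.KatoDescentPotSupersingularWildUpperUnitTwistRecordsFlat24
import Summits.BirchSwinnertonDyer.BirchSwinnertonDyer.Theorems.KatoDescentPotSupersingularWildUpperUnitTwistRecordsFlat29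
import Summits.BirchSwinnertonDyer.BirchSwinnertonDyer.Theorems.KatoDescentPotSupersingularWildUpperUnitTwistRecordsFlat52
import Summits.BirchSwinnertonDyer.BirchSwinnertonDyer.Theorems.KatoDescentPotSupersingularWildUpperUnitTwistRecordsFlat61
import Summits.BirchSwinnertonDyer.BirchSwinnertonDyer.Theorems.KatoDescentPotSupersingularWildUpperUnitTwistRecordsSharp15
import Summits.BirchSwinnertonDyer.BirchSwinnertonDyer.Theorems.KatoDescentPotSupersingularWildFineSelmerSupersingularCMAnchor
import Summits.BirchSwinnertonDyer.BirchSwinnertonDyer.Theorems.KatoDescentPotSupersingularWildUpperDivisionFieldFukudaDoor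
import Literature.NumberTheory.EllipticCurves.FineSelmerIsotypicClassGroupCriterion
import HarnessLib

/-!
# Route `KatoDescentPotSupersingular` (rung K9, sub-rung B5 = O6 wild `p = 3`, cell `bsd-potss`): per-row records on the FACT-FREE door L6
# (HOM-TRIVIAL form: `3 ∣ h(ℚ(E[3]))` but no `E[3]` in `Cl(ℚ(E[3])) ⊗ 𝔽₃`) — statement (A) of Coates–Sujatha at `(E, 3)` with NO named fact, and U₀ modulo `hKatoA hGZK hmod`, for K9 U₀-ns rows that had
# NO fact-free (A) record so far, part 12 (hom-trivial part 2 of 5): 223587w1, 249615g1, 249615i1, 292032bi1, 292032dr1, 292032fy1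
# (seat `bsd-potss-k9-c4` g24; same road as this seat's door file `…WildFineSelmerClassNumberL6Door` (p697251), inlined: one call of conjA-anchor
# g16/g17's kernel door L6 `CoatesSujatha2005.conjA_of_not_dvd_card_classGroup` per row; `--supports stmt-BirchSwinnertonDyer-19197 --as helper`)

HONEST FRAMING. THEOREMS ONLY (no definition, no named fact, no `sorry`); PER ROW — NOT a class theorem; nothing is booked; items 19189 / 19197 /
19942 / 19386 stay OPEN at class level (class-wide open input of record: the zeta crux 24327); Conjecture A and BSD are proved for NO class of
curves.  ROAD (door L6 of conjA-anchor g15 §9, KERNEL since g16/g17 2026-08-29; entry point `CoatesSujatha2005.conjA_of_homTrivial_divisionField`):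
`E[3]` irreducible (kernel `irr_g…_3`), `Δ(E)` a CUBE (kernel `Δ_cube_g…` ⟹ `ρ̄₃` not onto ⟹ `3 ∤ #Gal(ℚ(E[3])/ℚ)`), (c2*)₀ «every additive
`Γ_ℚ`-equivariant map `Cl(𝓞_ℚ(E[3])) → E[3]` is zero» (DISPLAYED `h0`; numerically: the `E[3]`-isotypic multiplicity of `Cl(ℚ(E[3])) ⊗ 𝔽₃` is
`m_ρ̄ = 0` although `3 ∣ h` — conjA-anchor g15 kit j313355 `drsl1` at layer 0 on the degree-16 field, isotypic projector from Frobenius traces, with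
the `E[3]`-vs-dual convention certified by explicit 3-torsion points kit j313432; class group CERTIFIED by `bnfcertify` kit j316482 where marked CERT,
else GRH), and `E(ℚ₃)[3] = 0` (DISPLAYED `hD`: no non-zero point of `E[3]` fixed by the decomposition group at `3`; `t3 = 1` of k9-c4 g7 kit j265757)
⟹ (A) at `(E,3)` for every cyclotomic `ℤ₃`-extension — NO NAMED FACT (`conjA_g…_3_L6h`); and U₀ modulo `hKatoA hGZK hmod` + Cremona's `r_an = 0`
(`missingUpperBoundAt_g…_3_L6h`).  NOTHING is assumed at the bad places.  SCOPE: the 29 K9 rows (all `3Nn`, `t3 = 1`) of conjA-anchor g15's L6 census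
with `3 ∣ h(ℚ(E[3]))` and `m_ρ̄ = 0`; none of them had a fact-free (A) record (disjoint from k8t-c4 g21's 167 NoCS rows and from parts 01–10's 61).
KERNEL lemmas `isElliptic_g…`, `isGloballyMinimal_g…`, `irr_g…_3`, `classO6_g…_3` are IMPORTED (k9-c4 g16–g18 / k8t-c4 g15 files, namespace
`…Theorems.WildUpperUnitTwistRecords`).

References: [CoatesSujatha2005] Thm. 3.4, Lemma 3.8; [DeoRaySujatha2023] Thm. 3.8/3.9 (b) (arXiv:2202.09937 pp. 9–10); [Washington1997] §13.3,
Thm. 10.4; [Serre1972] §2.4 Prop. 15, §5.3; [Kato2004Asterisque] Thm. 14.5 (3), Prop. 14.16 (2); [Cremona2006] Table 1.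
-/

set_option autoImplicit false
set_option linter.dupNamespace false

noncomputable section

open scoped Classical NumberField
open WeierstrassCurve NumberField Field IsDedekindDomain IntermediateField
  Literature.NumberTheory.EllipticCurves Literature.NumberTheory.EllipticCurves.Rank1Residual
  Literature.NumberTheory.EllipticCurves.Rank1Residual.Typed
  Literature.NumberTheory.GaloisRepresentations Literature.NumberTheory.SerreUniformity Literature.NumberTheory.IwasawaTheory
  Summit.BirchSwinnertonDyer.Rank1Residual Summit.BirchSwinnertonDyer.Rank1Residual.Additive
  Summit.BirchSwinnertonDyer.BirchSwinnertonDyer.Theorems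
  Summit.BirchSwinnertonDyer.BirchSwinnertonDyer.Theorems.WildUpperUnitTwistRecords

namespace Summit.BirchSwinnertonDyer.BirchSwinnertonDyer.Theorems.WildFineSelmerClassNumberL6Records

/-! ### `223587w1` @ `p = 3` — `N = 223587`; Cremona: `r_an = 0`; O6 wild at `3`; image `3Nn` (census); `ℚ(E[3])` of degree `16`: `h = 144` (CERT; `3 ∣ h`, `E[3]` ABSENT from `Cl ⊗ 𝔽₃`);
`m_ρ̄(Cl/3) = 0` (kit j313355/j313432); `#E(ℚ₃)[3] = 1` (kit j265757); bad places `7:1;13:1`. First fact-free (A) record for this row. -/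

/-- `Δ(223587w1) = ((-1565109))³` — a CUBE (kernel, `norm_num`). [cite: Serre1972, §5.3] [cite: Cremona2006, Table 1 (Cremona label 223587w1)] -/
theorem Δ_cube_g223587w1 : (⟨1, (-1), 1, 97819, 93441898⟩ : WeierstrassCurve ℚ).Δ = (((-1565109) : ℚ)) ^ 3 := by
  norm_num [WeierstrassCurve.Δ, WeierstrassCurve.b₂, WeierstrassCurve.b₄, WeierstrassCurve.b₆, WeierstrassCurve.b₈]

/-- **(A) AT `(223587w1, 3)` — NO NAMED FACT (hom-trivial door L6).**  Statement (A) of Coates–Sujatha for THIS curve at `p = 3` (the dual fine Selmer group over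
`ℚ_cyc` is finitely generated over `ℤ₃`, every cyclotomic `ℤ₃`-extension), by door L6 (hom-trivial form): KERNEL `irr_g223587w1_3`, `Δ_cube_g223587w1`;
DISPLAYED `h0` ((c2*)₀: no `E[3]` in `Cl(ℚ(E[3])) ⊗ 𝔽₃` — `h = 144`, `m_ρ̄ = 0`, CERT, kit j313355/j313432) and `hD` (`E(ℚ₃)[3] = 0`; `t3 = 1`, kit j265757).
Per row; nothing booked. [cite: CoatesSujatha2005, §3 Thm. 3.4, Lemma 3.8 and Cor. 3.6] [cite: DeoRaySujatha2023, §3 Thm. 3.8 (c2) (arXiv:2202.09937 p. 9)]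
[cite: Serre1972, §2.4 Prop. 15, §5.3] [cite: Cremona2006, Table 1 (Cremona label 223587w1)] -/
theorem conjA_g223587w1_3_L6h
    {W : WeierstrassCurve ℚ} [W.IsElliptic] (hWeq : W = (⟨1, (-1), 1, 97819, 93441898⟩ : WeierstrassCurve ℚ))
    (h0 : haveI : NumberField ↥(W.divisionField 3) := NumberField.mk
      ∀ μ : Additive (ClassGroup (𝓞 ↥(W.divisionField 3))) →+ geomTorsion W ((3 : ℕ) : ℤ),
        (∀ (τ : absoluteGaloisGroup ℚ) (c : ClassGroup (𝓞 ↥(W.divisionField 3))),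
          μ (Additive.ofMul (ClassGroup.mulEquiv
            (Literature.NumberTheory.NumberFields.AmbiguousClass.intAut (absRestrictNormalHom (W.divisionField 3) τ)) c)) =
            τ • μ (Additive.ofMul c)) → μ = 0)
    (hD : ∀ v : HeightOneSpectrum (𝓞 ℚ), ((3 : ℕ) : 𝓞 ℚ) ∈ v.asIdeal →
      ∀ x : geomTorsion W ((3 : ℕ) : ℤ), (∀ δ ∈ GreenbergSelmer.decomp v, δ • x = x) → x = 0)
    (κ : ZpExtension ℚ 3) (hκ : κ.IsCyclotomic) :
    ∃ (γ : absoluteGaloisGroup ℚ) (Df : W.FineSelmerDualData κ γ),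
      Module.Finite ℤ_[3] (RestrictScalars ℤ_[3] (IwasawaAlgebra 3) Df.X) := by
  subst hWeq
  haveI : Fact (Nat.Prime 3) := ⟨Nat.prime_three⟩
  haveI : NumberField ↥((⟨1, (-1), 1, 97819, 93441898⟩ : WeierstrassCurve ℚ).divisionField 3) := NumberField.mk
  exact CoatesSujatha2005.conjA_of_homTrivial_divisionField _ (by decide)
    (DivisionFieldFukudaDoor.not_dvd_card_aut_divisionField_three_of_Δ_eq_cube _ irr_g223587w1_3 Δ_cube_g223587w1) hκ h0 hD

/-- **RECORD — U₀ `ord₃ #Ш(E) ≤ ord₃ #Ш(E)_an` for `E = 223587w1` at `p = 3` on the fact-free door L6, hom-trivial form** (U₀-ns row of K9 items 19189 / 19197):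
KERNEL `classO6_g223587w1_3`, `irr_g223587w1_3`, `Δ_cube_g223587w1`; DISPLAYED named facts `hKatoA hGZK hmod` ONLY, Cremona's `r_an = 0` (`hr`), and the two
numerics `h0` (`m_ρ̄(Cl(ℚ(E[3]))/3) = 0`, `h = 144`, CERT) / `hD` (`#E(ℚ₃)[3] = 1`). Per row; nothing booked; BSD is not proved by this.
[cite: Kato2004Asterisque, Thm. 14.5 (3) (p. 236) and Prop. 14.16 (2)] [cite: CoatesSujatha2005, §3 Thm. 3.4]
[cite: DeoRaySujatha2023, §3 Thm. 3.8 (c2)] [cite: Cremona2006, Table 1 (Cremona label 223587w1)] -/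
theorem missingUpperBoundAt_g223587w1_3_L6h
    (hKatoA : Kato2004.rankZero_padicValNat_sha_add_padicValNat_tamagawa_le_of_additive_potGood_of_irreducible_of_fineSelmerDual_fg)
    (hGZK : rank_eq_analyticRank_of_analyticRank_le_one) (hmod : hasEntireLFunction_rat)
    {W : WeierstrassCurve ℚ} [W.IsElliptic] [W.IsGloballyMinimal] (hWeq : W = (⟨1, (-1), 1, 97819, 93441898⟩ : WeierstrassCurve ℚ)) (hr : W.analyticRank = 0)
    (h0 : haveI : NumberField ↥(W.divisionField 3) := NumberField.mk
      ∀ μ : Additive (ClassGroup (𝓞 ↥(W.divisionField 3))) →+ geomTorsion W ((3 : ℕ) : ℤ),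
        (∀ (τ : absoluteGaloisGroup ℚ) (c : ClassGroup (𝓞 ↥(W.divisionField 3))),
          μ (Additive.ofMul (ClassGroup.mulEquiv
            (Literature.NumberTheory.NumberFields.AmbiguousClass.intAut (absRestrictNormalHom (W.divisionField 3) τ)) c)) =
            τ • μ (Additive.ofMul c)) → μ = 0)
    (hD : ∀ v : HeightOneSpectrum (𝓞 ℚ), ((3 : ℕ) : 𝓞 ℚ) ∈ v.asIdeal →
      ∀ x : geomTorsion W ((3 : ℕ) : ℤ), (∀ δ ∈ GreenbergSelmer.decomp v, δ • x = x) → x = 0) :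
    MissingUpperBoundAt W 3 := by
  subst hWeq
  haveI : Fact (Nat.Prime 3) := ⟨Nat.prime_three⟩
  exact WildFineSelmerSupersingularCMAnchor.missingUpperBoundAt_wild_of_conjA hKatoA hGZK hmod _ hr classO6_g223587w1_3 irr_g223587w1_3
    (fun κ hκ => conjA_g223587w1_3_L6h rfl h0 hD κ hκ)

/-! ### `249615g1` @ `p = 3` — `N = 249615`; Cremona: `r_an = 0`; O6 wild at `3`; image `3Nn` (census); `ℚ(E[3])` of degree `16`: `h = 9` (CERT; `3 ∣ h`, `E[3]` ABSENT from `Cl ⊗ 𝔽₃`);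
`m_ρ̄(Cl/3) = 0` (kit j313355/j313432); `#E(ℚ₃)[3] = 1` (kit j265757); bad places `5:3;43:1`. First fact-free (A) record for this row. -/

/-- `Δ(249615g1) = (645)³` — a CUBE (kernel, `norm_num`). [cite: Serre1972, §5.3] [cite: Cremona2006, Table 1 (Cremona label 249615g1)] -/
theorem Δ_cube_g249615g1 : (⟨0, 0, 1, (-258), (-1387)⟩ : WeierstrassCurve ℚ).Δ = ((645 : ℚ)) ^ 3 := by
  norm_num [WeierstrassCurve.Δ, WeierstrassCurve.b₂, WeierstrassCurve.b₄, WeierstrassCurve.b₆, WeierstrassCurve.b₈]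

/-- **(A) AT `(249615g1, 3)` — NO NAMED FACT (hom-trivial door L6).**  Statement (A) of Coates–Sujatha for THIS curve at `p = 3` (the dual fine Selmer group over
`ℚ_cyc` is finitely generated over `ℤ₃`, every cyclotomic `ℤ₃`-extension), by door L6 (hom-trivial form): KERNEL `irr_g249615g1_3`, `Δ_cube_g249615g1`;
DISPLAYED `h0` ((c2*)₀: no `E[3]` in `Cl(ℚ(E[3])) ⊗ 𝔽₃` — `h = 9`, `m_ρ̄ = 0`, CERT, kit j313355/j313432) and `hD` (`E(ℚ₃)[3] = 0`; `t3 = 1`, kit j265757).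
Per row; nothing booked. [cite: CoatesSujatha2005, §3 Thm. 3.4, Lemma 3.8 and Cor. 3.6] [cite: DeoRaySujatha2023, §3 Thm. 3.8 (c2) (arXiv:2202.09937 p. 9)]
[cite: Serre1972, §2.4 Prop. 15, §5.3] [cite: Cremona2006, Table 1 (Cremona label 249615g1)] -/
theorem conjA_g249615g1_3_L6h
    {W : WeierstrassCurve ℚ} [W.IsElliptic] (hWeq : W = (⟨0, 0, 1, (-258), (-1387)⟩ : WeierstrassCurve ℚ))
    (h0 : haveI : NumberField ↥(W.divisionField 3) := NumberField.mk
      ∀ μ : Additive (ClassGroup (𝓞 ↥(W.divisionField 3))) →+ geomTorsion W ((3 : ℕ) : ℤ),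
        (∀ (τ : absoluteGaloisGroup ℚ) (c : ClassGroup (𝓞 ↥(W.divisionField 3))),
          μ (Additive.ofMul (ClassGroup.mulEquiv
            (Literature.NumberTheory.NumberFields.AmbiguousClass.intAut (absRestrictNormalHom (W.divisionField 3) τ)) c)) =
            τ • μ (Additive.ofMul c)) → μ = 0)
    (hD : ∀ v : HeightOneSpectrum (𝓞 ℚ), ((3 : ℕ) : 𝓞 ℚ) ∈ v.asIdeal →
      ∀ x : geomTorsion W ((3 : ℕ) : ℤ), (∀ δ ∈ GreenbergSelmer.decomp v, δ • x = x) → x = 0)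
    (κ : ZpExtension ℚ 3) (hκ : κ.IsCyclotomic) :
    ∃ (γ : absoluteGaloisGroup ℚ) (Df : W.FineSelmerDualData κ γ),
      Module.Finite ℤ_[3] (RestrictScalars ℤ_[3] (IwasawaAlgebra 3) Df.X) := by
  subst hWeq
  haveI : Fact (Nat.Prime 3) := ⟨Nat.prime_three⟩
  haveI : NumberField ↥((⟨0, 0, 1, (-258), (-1387)⟩ : WeierstrassCurve ℚ).divisionField 3) := NumberField.mk
  exact CoatesSujatha2005.conjA_of_homTrivial_divisionField _ (by decide)
    (DivisionFieldFukudaDoor.not_dvd_card_aut_divisionField_three_of_Δ_eq_cube _ irr_g249615g1_3 Δ_cube_g249615g1) hκ h0 hD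

/-- **RECORD — U₀ `ord₃ #Ш(E) ≤ ord₃ #Ш(E)_an` for `E = 249615g1` at `p = 3` on the fact-free door L6, hom-trivial form** (U₀-ns row of K9 items 19189 / 19197):
KERNEL `classO6_g249615g1_3`, `irr_g249615g1_3`, `Δ_cube_g249615g1`; DISPLAYED named facts `hKatoA hGZK hmod` ONLY, Cremona's `r_an = 0` (`hr`), and the two
numerics `h0` (`m_ρ̄(Cl(ℚ(E[3]))/3) = 0`, `h = 9`, CERT) / `hD` (`#E(ℚ₃)[3] = 1`). Per row; nothing booked; BSD is not proved by this.
[cite: Kato2004Asterisque, Thm. 14.5 (3) (p. 236) and Prop. 14.16 (2)] [cite: CoatesSujatha2005, §3 Thm. 3.4]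
[cite: DeoRaySujatha2023, §3 Thm. 3.8 (c2)] [cite: Cremona2006, Table 1 (Cremona label 249615g1)] -/
theorem missingUpperBoundAt_g249615g1_3_L6h
    (hKatoA : Kato2004.rankZero_padicValNat_sha_add_padicValNat_tamagawa_le_of_additive_potGood_of_irreducible_of_fineSelmerDual_fg)
    (hGZK : rank_eq_analyticRank_of_analyticRank_le_one) (hmod : hasEntireLFunction_rat)
    {W : WeierstrassCurve ℚ} [W.IsElliptic] [W.IsGloballyMinimal] (hWeq : W = (⟨0, 0, 1, (-258), (-1387)⟩ : WeierstrassCurve ℚ)) (hr : W.analyticRank = 0)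
    (h0 : haveI : NumberField ↥(W.divisionField 3) := NumberField.mk
      ∀ μ : Additive (ClassGroup (𝓞 ↥(W.divisionField 3))) →+ geomTorsion W ((3 : ℕ) : ℤ),
        (∀ (τ : absoluteGaloisGroup ℚ) (c : ClassGroup (𝓞 ↥(W.divisionField 3))),
          μ (Additive.ofMul (ClassGroup.mulEquiv
            (Literature.NumberTheory.NumberFields.AmbiguousClass.intAut (absRestrictNormalHom (W.divisionField 3) τ)) c)) =
            τ • μ (Additive.ofMul c)) → μ = 0)
    (hD : ∀ v : HeightOneSpectrum (𝓞 ℚ), ((3 : ℕ) : 𝓞 ℚ) ∈ v.asIdeal →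
      ∀ x : geomTorsion W ((3 : ℕ) : ℤ), (∀ δ ∈ GreenbergSelmer.decomp v, δ • x = x) → x = 0) :
    MissingUpperBoundAt W 3 := by
  subst hWeq
  haveI : Fact (Nat.Prime 3) := ⟨Nat.prime_three⟩
  exact WildFineSelmerSupersingularCMAnchor.missingUpperBoundAt_wild_of_conjA hKatoA hGZK hmod _ hr classO6_g249615g1_3 irr_g249615g1_3
    (fun κ hκ => conjA_g249615g1_3_L6h rfl h0 hD κ hκ)

/-! ### `249615i1` @ `p = 3` — `N = 249615`; Cremona: `r_an = 0`; O6 wild at `3`; image `3Nn` (census); `ℚ(E[3])` of degree `16`: `h = 9` (GRH; `3 ∣ h`, `E[3]` ABSENT from `Cl ⊗ 𝔽₃`);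
`m_ρ̄(Cl/3) = 0` (kit j313355/j313432); `#E(ℚ₃)[3] = 1` (kit j265757); bad places `5:3;43:1`. First fact-free (A) record for this row. -/

/-- `Δ(249615i1) = (1192605)³` — a CUBE (kernel, `norm_num`). [cite: Serre1972, §5.3] [cite: Cremona2006, Table 1 (Cremona label 249615i1)] -/
theorem Δ_cube_g249615i1 : (⟨0, 0, 1, (-477042), 110256332⟩ : WeierstrassCurve ℚ).Δ = ((1192605 : ℚ)) ^ 3 := by
  norm_num [WeierstrassCurve.Δ, WeierstrassCurve.b₂, WeierstrassCurve.b₄, WeierstrassCurve.b₆, WeierstrassCurve.b₈]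

/-- **(A) AT `(249615i1, 3)` — NO NAMED FACT (hom-trivial door L6).**  Statement (A) of Coates–Sujatha for THIS curve at `p = 3` (the dual fine Selmer group over
`ℚ_cyc` is finitely generated over `ℤ₃`, every cyclotomic `ℤ₃`-extension), by door L6 (hom-trivial form): KERNEL `irr_g249615i1_3`, `Δ_cube_g249615i1`;
DISPLAYED `h0` ((c2*)₀: no `E[3]` in `Cl(ℚ(E[3])) ⊗ 𝔽₃` — `h = 9`, `m_ρ̄ = 0`, GRH, kit j313355/j313432) and `hD` (`E(ℚ₃)[3] = 0`; `t3 = 1`, kit j265757).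
Per row; nothing booked. [cite: CoatesSujatha2005, §3 Thm. 3.4, Lemma 3.8 and Cor. 3.6] [cite: DeoRaySujatha2023, §3 Thm. 3.8 (c2) (arXiv:2202.09937 p. 9)]
[cite: Serre1972, §2.4 Prop. 15, §5.3] [cite: Cremona2006, Table 1 (Cremona label 249615i1)] -/
theorem conjA_g249615i1_3_L6h
    {W : WeierstrassCurve ℚ} [W.IsElliptic] (hWeq : W = (⟨0, 0, 1, (-477042), 110256332⟩ : WeierstrassCurve ℚ))
    (h0 : haveI : NumberField ↥(W.divisionField 3) := NumberField.mk
      ∀ μ : Additive (ClassGroup (𝓞 ↥(W.divisionField 3))) →+ geomTorsion W ((3 : ℕ) : ℤ),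
        (∀ (τ : absoluteGaloisGroup ℚ) (c : ClassGroup (𝓞 ↥(W.divisionField 3))),
          μ (Additive.ofMul (ClassGroup.mulEquiv
            (Literature.NumberTheory.NumberFields.AmbiguousClass.intAut (absRestrictNormalHom (W.divisionField 3) τ)) c)) =
            τ • μ (Additive.ofMul c)) → μ = 0)
    (hD : ∀ v : HeightOneSpectrum (𝓞 ℚ), ((3 : ℕ) : 𝓞 ℚ) ∈ v.asIdeal →
      ∀ x : geomTorsion W ((3 : ℕ) : ℤ), (∀ δ ∈ GreenbergSelmer.decomp v, δ • x = x) → x = 0)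
    (κ : ZpExtension ℚ 3) (hκ : κ.IsCyclotomic) :
    ∃ (γ : absoluteGaloisGroup ℚ) (Df : W.FineSelmerDualData κ γ),
      Module.Finite ℤ_[3] (RestrictScalars ℤ_[3] (IwasawaAlgebra 3) Df.X) := by
  subst hWeq
  haveI : Fact (Nat.Prime 3) := ⟨Nat.prime_three⟩
  haveI : NumberField ↥((⟨0, 0, 1, (-477042), 110256332⟩ : WeierstrassCurve ℚ).divisionField 3) := NumberField.mk
  exact CoatesSujatha2005.conjA_of_homTrivial_divisionField _ (by decide)
    (DivisionFieldFukudaDoor.not_dvd_card_aut_divisionField_three_of_Δ_eq_cube _ irr_g249615i1_3 Δ_cube_g249615i1) hκ h0 hD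

/-- **RECORD — U₀ `ord₃ #Ш(E) ≤ ord₃ #Ш(E)_an` for `E = 249615i1` at `p = 3` on the fact-free door L6, hom-trivial form** (U₀-ns row of K9 items 19189 / 19197):
KERNEL `classO6_g249615i1_3`, `irr_g249615i1_3`, `Δ_cube_g249615i1`; DISPLAYED named facts `hKatoA hGZK hmod` ONLY, Cremona's `r_an = 0` (`hr`), and the two
numerics `h0` (`m_ρ̄(Cl(ℚ(E[3]))/3) = 0`, `h = 9`, GRH) / `hD` (`#E(ℚ₃)[3] = 1`). Per row; nothing booked; BSD is not proved by this.
[cite: Kato2004Asterisque, Thm. 14.5 (3) (p. 236) and Prop. 14.16 (2)] [cite: CoatesSujatha2005, §3 Thm. 3.4]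
[cite: DeoRaySujatha2023, §3 Thm. 3.8 (c2)] [cite: Cremona2006, Table 1 (Cremona label 249615i1)] -/
theorem missingUpperBoundAt_g249615i1_3_L6h
    (hKatoA : Kato2004.rankZero_padicValNat_sha_add_padicValNat_tamagawa_le_of_additive_potGood_of_irreducible_of_fineSelmerDual_fg)
    (hGZK : rank_eq_analyticRank_of_analyticRank_le_one) (hmod : hasEntireLFunction_rat)
    {W : WeierstrassCurve ℚ} [W.IsElliptic] [W.IsGloballyMinimal] (hWeq : W = (⟨0, 0, 1, (-477042), 110256332⟩ : WeierstrassCurve ℚ)) (hr : W.analyticRank = 0)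
    (h0 : haveI : NumberField ↥(W.divisionField 3) := NumberField.mk
      ∀ μ : Additive (ClassGroup (𝓞 ↥(W.divisionField 3))) →+ geomTorsion W ((3 : ℕ) : ℤ),
        (∀ (τ : absoluteGaloisGroup ℚ) (c : ClassGroup (𝓞 ↥(W.divisionField 3))),
          μ (Additive.ofMul (ClassGroup.mulEquiv
            (Literature.NumberTheory.NumberFields.AmbiguousClass.intAut (absRestrictNormalHom (W.divisionField 3) τ)) c)) =
            τ • μ (Additive.ofMul c)) → μ = 0)
    (hD : ∀ v : HeightOneSpectrum (𝓞 ℚ), ((3 : ℕ) : 𝓞 ℚ) ∈ v.asIdeal →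
      ∀ x : geomTorsion W ((3 : ℕ) : ℤ), (∀ δ ∈ GreenbergSelmer.decomp v, δ • x = x) → x = 0) :
    MissingUpperBoundAt W 3 := by
  subst hWeq
  haveI : Fact (Nat.Prime 3) := ⟨Nat.prime_three⟩
  exact WildFineSelmerSupersingularCMAnchor.missingUpperBoundAt_wild_of_conjA hKatoA hGZK hmod _ hr classO6_g249615i1_3 irr_g249615i1_3
    (fun κ hκ => conjA_g249615i1_3_L6h rfl h0 hD κ hκ)

/-! ### `292032bi1` @ `p = 3` — `N = 292032`; Cremona: `r_an = 0`; O6 wild at `3`; image `3Nn` (census); `ℚ(E[3])` of degree `16`: `h = 72` (CERT; `3 ∣ h`, `E[3]` ABSENT from `Cl ⊗ 𝔽₃`);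
`m_ρ̄(Cl/3) = 0` (kit j313355/j313432); `#E(ℚ₃)[3] = 1` (kit j265757); bad places `2:1;13:1`. First fact-free (A) record for this row. -/

/-- `Δ(292032bi1) = ((-18252))³` — a CUBE (kernel, `norm_num`). [cite: Serre1972, §5.3] [cite: Cremona2006, Table 1 (Cremona label 292032bi1)] -/
theorem Δ_cube_g292032bi1 : (⟨0, 0, 0, (-9126), 355914⟩ : WeierstrassCurve ℚ).Δ = (((-18252) : ℚ)) ^ 3 := by
  norm_num [WeierstrassCurve.Δ, WeierstrassCurve.b₂, WeierstrassCurve.b₄, WeierstrassCurve.b₆, WeierstrassCurve.b₈]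

/-- **(A) AT `(292032bi1, 3)` — NO NAMED FACT (hom-trivial door L6).**  Statement (A) of Coates–Sujatha for THIS curve at `p = 3` (the dual fine Selmer group over
`ℚ_cyc` is finitely generated over `ℤ₃`, every cyclotomic `ℤ₃`-extension), by door L6 (hom-trivial form): KERNEL `irr_g292032bi1_3`, `Δ_cube_g292032bi1`;
DISPLAYED `h0` ((c2*)₀: no `E[3]` in `Cl(ℚ(E[3])) ⊗ 𝔽₃` — `h = 72`, `m_ρ̄ = 0`, CERT, kit j313355/j313432) and `hD` (`E(ℚ₃)[3] = 0`; `t3 = 1`, kit j265757).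
Per row; nothing booked. [cite: CoatesSujatha2005, §3 Thm. 3.4, Lemma 3.8 and Cor. 3.6] [cite: DeoRaySujatha2023, §3 Thm. 3.8 (c2) (arXiv:2202.09937 p. 9)]
[cite: Serre1972, §2.4 Prop. 15, §5.3] [cite: Cremona2006, Table 1 (Cremona label 292032bi1)] -/
theorem conjA_g292032bi1_3_L6h
    {W : WeierstrassCurve ℚ} [W.IsElliptic] (hWeq : W = (⟨0, 0, 0, (-9126), 355914⟩ : WeierstrassCurve ℚ))
    (h0 : haveI : NumberField ↥(W.divisionField 3) := NumberField.mk
      ∀ μ : Additive (ClassGroup (𝓞 ↥(W.divisionField 3))) →+ geomTorsion W ((3 : ℕ) : ℤ),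
        (∀ (τ : absoluteGaloisGroup ℚ) (c : ClassGroup (𝓞 ↥(W.divisionField 3))),
          μ (Additive.ofMul (ClassGroup.mulEquiv
            (Literature.NumberTheory.NumberFields.AmbiguousClass.intAut (absRestrictNormalHom (W.divisionField 3) τ)) c)) =
            τ • μ (Additive.ofMul c)) → μ = 0)
    (hD : ∀ v : HeightOneSpectrum (𝓞 ℚ), ((3 : ℕ) : 𝓞 ℚ) ∈ v.asIdeal →
      ∀ x : geomTorsion W ((3 : ℕ) : ℤ), (∀ δ ∈ GreenbergSelmer.decomp v, δ • x = x) → x = 0)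
    (κ : ZpExtension ℚ 3) (hκ : κ.IsCyclotomic) :
    ∃ (γ : absoluteGaloisGroup ℚ) (Df : W.FineSelmerDualData κ γ),
      Module.Finite ℤ_[3] (RestrictScalars ℤ_[3] (IwasawaAlgebra 3) Df.X) := by
  subst hWeq
  haveI : Fact (Nat.Prime 3) := ⟨Nat.prime_three⟩
  haveI : NumberField ↥((⟨0, 0, 0, (-9126), 355914⟩ : WeierstrassCurve ℚ).divisionField 3) := NumberField.mk
  exact CoatesSujatha2005.conjA_of_homTrivial_divisionField _ (by decide)
    (DivisionFieldFukudaDoor.not_dvd_card_aut_divisionField_three_of_Δ_eq_cube _ irr_g292032bi1_3 Δ_cube_g292032bi1) hκ h0 hD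

/-- **RECORD — U₀ `ord₃ #Ш(E) ≤ ord₃ #Ш(E)_an` for `E = 292032bi1` at `p = 3` on the fact-free door L6, hom-trivial form** (U₀-ns row of K9 items 19189 / 19197):
KERNEL `classO6_g292032bi1_3`, `irr_g292032bi1_3`, `Δ_cube_g292032bi1`; DISPLAYED named facts `hKatoA hGZK hmod` ONLY, Cremona's `r_an = 0` (`hr`), and the two
numerics `h0` (`m_ρ̄(Cl(ℚ(E[3]))/3) = 0`, `h = 72`, CERT) / `hD` (`#E(ℚ₃)[3] = 1`). Per row; nothing booked; BSD is not proved by this.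
[cite: Kato2004Asterisque, Thm. 14.5 (3) (p. 236) and Prop. 14.16 (2)] [cite: CoatesSujatha2005, §3 Thm. 3.4]
[cite: DeoRaySujatha2023, §3 Thm. 3.8 (c2)] [cite: Cremona2006, Table 1 (Cremona label 292032bi1)] -/
theorem missingUpperBoundAt_g292032bi1_3_L6h
    (hKatoA : Kato2004.rankZero_padicValNat_sha_add_padicValNat_tamagawa_le_of_additive_potGood_of_irreducible_of_fineSelmerDual_fg)
    (hGZK : rank_eq_analyticRank_of_analyticRank_le_one) (hmod : hasEntireLFunction_rat)
    {W : WeierstrassCurve ℚ} [W.IsElliptic] [W.IsGloballyMinimal] (hWeq : W = (⟨0, 0, 0, (-9126), 355914⟩ : WeierstrassCurve ℚ)) (hr : W.analyticRank = 0)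
    (h0 : haveI : NumberField ↥(W.divisionField 3) := NumberField.mk
      ∀ μ : Additive (ClassGroup (𝓞 ↥(W.divisionField 3))) →+ geomTorsion W ((3 : ℕ) : ℤ),
        (∀ (τ : absoluteGaloisGroup ℚ) (c : ClassGroup (𝓞 ↥(W.divisionField 3))),
          μ (Additive.ofMul (ClassGroup.mulEquiv
            (Literature.NumberTheory.NumberFields.AmbiguousClass.intAut (absRestrictNormalHom (W.divisionField 3) τ)) c)) =
            τ • μ (Additive.ofMul c)) → μ = 0)
    (hD : ∀ v : HeightOneSpectrum (𝓞 ℚ), ((3 : ℕ) : 𝓞 ℚ) ∈ v.asIdeal →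
      ∀ x : geomTorsion W ((3 : ℕ) : ℤ), (∀ δ ∈ GreenbergSelmer.decomp v, δ • x = x) → x = 0) :
    MissingUpperBoundAt W 3 := by
  subst hWeq
  haveI : Fact (Nat.Prime 3) := ⟨Nat.prime_three⟩
  exact WildFineSelmerSupersingularCMAnchor.missingUpperBoundAt_wild_of_conjA hKatoA hGZK hmod _ hr classO6_g292032bi1_3 irr_g292032bi1_3
    (fun κ hκ => conjA_g292032bi1_3_L6h rfl h0 hD κ hκ)

/-! ### `292032dr1` @ `p = 3` — `N = 292032`; Cremona: `r_an = 0`; O6 wild at `3`; image `3Nn` (census); `ℚ(E[3])` of degree `16`: `h = 2304` (GRH; `3 ∣ h`, `E[3]` ABSENT from `Cl ⊗ 𝔽₃`);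
`m_ρ̄(Cl/3) = 0` (kit j313355/j313432); `#E(ℚ₃)[3] = 1` (kit j265757); bad places `2:1;13:1`. First fact-free (A) record for this row. -/

/-- `Δ(292032dr1) = (11232)³` — a CUBE (kernel, `norm_num`). [cite: Serre1972, §5.3] [cite: Cremona2006, Table 1 (Cremona label 292032dr1)] -/
theorem Δ_cube_g292032dr1 : (⟨0, 0, 0, (-7020), (-219024)⟩ : WeierstrassCurve ℚ).Δ = ((11232 : ℚ)) ^ 3 := by
  norm_num [WeierstrassCurve.Δ, WeierstrassCurve.b₂, WeierstrassCurve.b₄, WeierstrassCurve.b₆, WeierstrassCurve.b₈]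

/-- **(A) AT `(292032dr1, 3)` — NO NAMED FACT (hom-trivial door L6).**  Statement (A) of Coates–Sujatha for THIS curve at `p = 3` (the dual fine Selmer group over
`ℚ_cyc` is finitely generated over `ℤ₃`, every cyclotomic `ℤ₃`-extension), by door L6 (hom-trivial form): KERNEL `irr_g292032dr1_3`, `Δ_cube_g292032dr1`;
DISPLAYED `h0` ((c2*)₀: no `E[3]` in `Cl(ℚ(E[3])) ⊗ 𝔽₃` — `h = 2304`, `m_ρ̄ = 0`, GRH, kit j313355/j313432) and `hD` (`E(ℚ₃)[3] = 0`; `t3 = 1`, kit j265757).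
Per row; nothing booked. [cite: CoatesSujatha2005, §3 Thm. 3.4, Lemma 3.8 and Cor. 3.6] [cite: DeoRaySujatha2023, §3 Thm. 3.8 (c2) (arXiv:2202.09937 p. 9)]
[cite: Serre1972, §2.4 Prop. 15, §5.3] [cite: Cremona2006, Table 1 (Cremona label 292032dr1)] -/
theorem conjA_g292032dr1_3_L6h
    {W : WeierstrassCurve ℚ} [W.IsElliptic] (hWeq : W = (⟨0, 0, 0, (-7020), (-219024)⟩ : WeierstrassCurve ℚ))
    (h0 : haveI : NumberField ↥(W.divisionField 3) := NumberField.mk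
      ∀ μ : Additive (ClassGroup (𝓞 ↥(W.divisionField 3))) →+ geomTorsion W ((3 : ℕ) : ℤ),
        (∀ (τ : absoluteGaloisGroup ℚ) (c : ClassGroup (𝓞 ↥(W.divisionField 3))),
          μ (Additive.ofMul (ClassGroup.mulEquiv
            (Literature.NumberTheory.NumberFields.AmbiguousClass.intAut (absRestrictNormalHom (W.divisionField 3) τ)) c)) =
            τ • μ (Additive.ofMul c)) → μ = 0)
    (hD : ∀ v : HeightOneSpectrum (𝓞 ℚ), ((3 : ℕ) : 𝓞 ℚ) ∈ v.asIdeal →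
      ∀ x : geomTorsion W ((3 : ℕ) : ℤ), (∀ δ ∈ GreenbergSelmer.decomp v, δ • x = x) → x = 0)
    (κ : ZpExtension ℚ 3) (hκ : κ.IsCyclotomic) :
    ∃ (γ : absoluteGaloisGroup ℚ) (Df : W.FineSelmerDualData κ γ),
      Module.Finite ℤ_[3] (RestrictScalars ℤ_[3] (IwasawaAlgebra 3) Df.X) := by
  subst hWeq
  haveI : Fact (Nat.Prime 3) := ⟨Nat.prime_three⟩
  haveI : NumberField ↥((⟨0, 0, 0, (-7020), (-219024)⟩ : WeierstrassCurve ℚ).divisionField 3) := NumberField.mk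
  exact CoatesSujatha2005.conjA_of_homTrivial_divisionField _ (by decide)
    (DivisionFieldFukudaDoor.not_dvd_card_aut_divisionField_three_of_Δ_eq_cube _ irr_g292032dr1_3 Δ_cube_g292032dr1) hκ h0 hD

/-- **RECORD — U₀ `ord₃ #Ш(E) ≤ ord₃ #Ш(E)_an` for `E = 292032dr1` at `p = 3` on the fact-free door L6, hom-trivial form** (U₀-ns row of K9 items 19189 / 19197):
KERNEL `classO6_g292032dr1_3`, `irr_g292032dr1_3`, `Δ_cube_g292032dr1`; DISPLAYED named facts `hKatoA hGZK hmod` ONLY, Cremona's `r_an = 0` (`hr`), and the two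
numerics `h0` (`m_ρ̄(Cl(ℚ(E[3]))/3) = 0`, `h = 2304`, GRH) / `hD` (`#E(ℚ₃)[3] = 1`). Per row; nothing booked; BSD is not proved by this.
[cite: Kato2004Asterisque, Thm. 14.5 (3) (p. 236) and Prop. 14.16 (2)] [cite: CoatesSujatha2005, §3 Thm. 3.4]
[cite: DeoRaySujatha2023, §3 Thm. 3.8 (c2)] [cite: Cremona2006, Table 1 (Cremona label 292032dr1)] -/
theorem missingUpperBoundAt_g292032dr1_3_L6h
    (hKatoA : Kato2004.rankZero_padicValNat_sha_add_padicValNat_tamagawa_le_of_additive_potGood_of_irreducible_of_fineSelmerDual_fg)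
    (hGZK : rank_eq_analyticRank_of_analyticRank_le_one) (hmod : hasEntireLFunction_rat)
    {W : WeierstrassCurve ℚ} [W.IsElliptic] [W.IsGloballyMinimal] (hWeq : W = (⟨0, 0, 0, (-7020), (-219024)⟩ : WeierstrassCurve ℚ)) (hr : W.analyticRank = 0)
    (h0 : haveI : NumberField ↥(W.divisionField 3) := NumberField.mk
      ∀ μ : Additive (ClassGroup (𝓞 ↥(W.divisionField 3))) →+ geomTorsion W ((3 : ℕ) : ℤ),
        (∀ (τ : absoluteGaloisGroup ℚ) (c : ClassGroup (𝓞 ↥(W.divisionField 3))),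
          μ (Additive.ofMul (ClassGroup.mulEquiv
            (Literature.NumberTheory.NumberFields.AmbiguousClass.intAut (absRestrictNormalHom (W.divisionField 3) τ)) c)) =
            τ • μ (Additive.ofMul c)) → μ = 0)
    (hD : ∀ v : HeightOneSpectrum (𝓞 ℚ), ((3 : ℕ) : 𝓞 ℚ) ∈ v.asIdeal →
      ∀ x : geomTorsion W ((3 : ℕ) : ℤ), (∀ δ ∈ GreenbergSelmer.decomp v, δ • x = x) → x = 0) :
    MissingUpperBoundAt W 3 := by
  subst hWeq
  haveI : Fact (Nat.Prime 3) := ⟨Nat.prime_three⟩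
  exact WildFineSelmerSupersingularCMAnchor.missingUpperBoundAt_wild_of_conjA hKatoA hGZK hmod _ hr classO6_g292032dr1_3 irr_g292032dr1_3
    (fun κ hκ => conjA_g292032dr1_3_L6h rfl h0 hD κ hκ)

/-! ### `292032fy1` @ `p = 3` — `N = 292032`; Cremona: `r_an = 0`; O6 wild at `3`; image `3Nn` (census); `ℚ(E[3])` of degree `16`: `h = 72` (CERT; `3 ∣ h`, `E[3]` ABSENT from `Cl ⊗ 𝔽₃`);
`m_ρ̄(Cl/3) = 0` (kit j313355/j313432); `#E(ℚ₃)[3] = 1` (kit j265757); bad places `2:1;13:1`. First fact-free (A) record for this row. -/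

/-- `Δ(292032fy1) = ((-146016))³` — a CUBE (kernel, `norm_num`). [cite: Serre1972, §5.3] [cite: Cremona2006, Table 1 (Cremona label 292032fy1)] -/
theorem Δ_cube_g292032fy1 : (⟨0, 0, 0, (-18252), (-2847312)⟩ : WeierstrassCurve ℚ).Δ = (((-146016) : ℚ)) ^ 3 := by
  norm_num [WeierstrassCurve.Δ, WeierstrassCurve.b₂, WeierstrassCurve.b₄, WeierstrassCurve.b₆, WeierstrassCurve.b₈]

/-- **(A) AT `(292032fy1, 3)` — NO NAMED FACT (hom-trivial door L6).**  Statement (A) of Coates–Sujatha for THIS curve at `p = 3` (the dual fine Selmer group over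
`ℚ_cyc` is finitely generated over `ℤ₃`, every cyclotomic `ℤ₃`-extension), by door L6 (hom-trivial form): KERNEL `irr_g292032fy1_3`, `Δ_cube_g292032fy1`;
DISPLAYED `h0` ((c2*)₀: no `E[3]` in `Cl(ℚ(E[3])) ⊗ 𝔽₃` — `h = 72`, `m_ρ̄ = 0`, CERT, kit j313355/j313432) and `hD` (`E(ℚ₃)[3] = 0`; `t3 = 1`, kit j265757).
Per row; nothing booked. [cite: CoatesSujatha2005, §3 Thm. 3.4, Lemma 3.8 and Cor. 3.6] [cite: DeoRaySujatha2023, §3 Thm. 3.8 (c2) (arXiv:2202.09937 p. 9)]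
[cite: Serre1972, §2.4 Prop. 15, §5.3] [cite: Cremona2006, Table 1 (Cremona label 292032fy1)] -/
theorem conjA_g292032fy1_3_L6h
    {W : WeierstrassCurve ℚ} [W.IsElliptic] (hWeq : W = (⟨0, 0, 0, (-18252), (-2847312)⟩ : WeierstrassCurve ℚ))
    (h0 : haveI : NumberField ↥(W.divisionField 3) := NumberField.mk
      ∀ μ : Additive (ClassGroup (𝓞 ↥(W.divisionField 3))) →+ geomTorsion W ((3 : ℕ) : ℤ),
        (∀ (τ : absoluteGaloisGroup ℚ) (c : ClassGroup (𝓞 ↥(W.divisionField 3))),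
          μ (Additive.ofMul (ClassGroup.mulEquiv
            (Literature.NumberTheory.NumberFields.AmbiguousClass.intAut (absRestrictNormalHom (W.divisionField 3) τ)) c)) =
            τ • μ (Additive.ofMul c)) → μ = 0)
    (hD : ∀ v : HeightOneSpectrum (𝓞 ℚ), ((3 : ℕ) : 𝓞 ℚ) ∈ v.asIdeal →
      ∀ x : geomTorsion W ((3 : ℕ) : ℤ), (∀ δ ∈ GreenbergSelmer.decomp v, δ • x = x) → x = 0)
    (κ : ZpExtension ℚ 3) (hκ : κ.IsCyclotomic) :
    ∃ (γ : absoluteGaloisGroup ℚ) (Df : W.FineSelmerDualData κ γ),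
      Module.Finite ℤ_[3] (RestrictScalars ℤ_[3] (IwasawaAlgebra 3) Df.X) := by
  subst hWeq
  haveI : Fact (Nat.Prime 3) := ⟨Nat.prime_three⟩
  haveI : NumberField ↥((⟨0, 0, 0, (-18252), (-2847312)⟩ : WeierstrassCurve ℚ).divisionField 3) := NumberField.mk
  exact CoatesSujatha2005.conjA_of_homTrivial_divisionField _ (by decide)
    (DivisionFieldFukudaDoor.not_dvd_card_aut_divisionField_three_of_Δ_eq_cube _ irr_g292032fy1_3 Δ_cube_g292032fy1) hκ h0 hD

/-- **RECORD — U₀ `ord₃ #Ш(E) ≤ ord₃ #Ш(E)_an` for `E = 292032fy1` at `p = 3` on the fact-free door L6, hom-trivial form** (U₀-ns row of K9 items 19189 / 19197):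
KERNEL `classO6_g292032fy1_3`, `irr_g292032fy1_3`, `Δ_cube_g292032fy1`; DISPLAYED named facts `hKatoA hGZK hmod` ONLY, Cremona's `r_an = 0` (`hr`), and the two
numerics `h0` (`m_ρ̄(Cl(ℚ(E[3]))/3) = 0`, `h = 72`, CERT) / `hD` (`#E(ℚ₃)[3] = 1`). Per row; nothing booked; BSD is not proved by this.
[cite: Kato2004Asterisque, Thm. 14.5 (3) (p. 236) and Prop. 14.16 (2)] [cite: CoatesSujatha2005, §3 Thm. 3.4]
[cite: DeoRaySujatha2023, §3 Thm. 3.8 (c2)] [cite: Cremona2006, Table 1 (Cremona label 292032fy1)] -/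
theorem missingUpperBoundAt_g292032fy1_3_L6h
    (hKatoA : Kato2004.rankZero_padicValNat_sha_add_padicValNat_tamagawa_le_of_additive_potGood_of_irreducible_of_fineSelmerDual_fg)
    (hGZK : rank_eq_analyticRank_of_analyticRank_le_one) (hmod : hasEntireLFunction_rat)
    {W : WeierstrassCurve ℚ} [W.IsElliptic] [W.IsGloballyMinimal] (hWeq : W = (⟨0, 0, 0, (-18252), (-2847312)⟩ : WeierstrassCurve ℚ)) (hr : W.analyticRank = 0)
    (h0 : haveI : NumberField ↥(W.divisionField 3) := NumberField.mk
      ∀ μ : Additive (ClassGroup (𝓞 ↥(W.divisionField 3))) →+ geomTorsion W ((3 : ℕ) : ℤ),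
        (∀ (τ : absoluteGaloisGroup ℚ) (c : ClassGroup (𝓞 ↥(W.divisionField 3))),
          μ (Additive.ofMul (ClassGroup.mulEquiv
            (Literature.NumberTheory.NumberFields.AmbiguousClass.intAut (absRestrictNormalHom (W.divisionField 3) τ)) c)) =
            τ • μ (Additive.ofMul c)) → μ = 0)
    (hD : ∀ v : HeightOneSpectrum (𝓞 ℚ), ((3 : ℕ) : 𝓞 ℚ) ∈ v.asIdeal →
      ∀ x : geomTorsion W ((3 : ℕ) : ℤ), (∀ δ ∈ GreenbergSelmer.decomp v, δ • x = x) → x = 0) :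
    MissingUpperBoundAt W 3 := by
  subst hWeq
  haveI : Fact (Nat.Prime 3) := ⟨Nat.prime_three⟩
  exact WildFineSelmerSupersingularCMAnchor.missingUpperBoundAt_wild_of_conjA hKatoA hGZK hmod _ hr classO6_g292032fy1_3 irr_g292032fy1_3
    (fun κ hκ => conjA_g292032fy1_3_L6h rfl h0 hD κ hκ)

end Summit.BirchSwinnertonDyer.BirchSwinnertonDyer.Theorems.WildFineSelmerClassNumberL6Records

end
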